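import Literature.MathematicalPhysics.QuantumFieldTheory.Balaban1983to89.B5RealFields
import Literature.MathematicalPhysics.QuantumFieldTheory.Balaban1983to89.B5G183Zero
import Literature.MathematicalPhysics.QuantumFieldTheory.Balaban1983to89.B5G183CovDecay

/-!
# `Balaban1983to89.B5G183Kernel` — the POSITION-SPACE KERNEL of `G = Δ_a⁻¹` on the torus `T_η` as the finite Fourier-inversion sum of the (1.83) blocks over coarse momenta `p′` and alias offsets `l, l′`; at `a = 1` the blocks ARE the continued symbol `g183(p′)` for EVERY `p′` (also `p′ = 0`), and on block points `x = n·y + r` the kernel is the coarse-torus Fourier inversion of the fine-offset multiplier `Σ_{l,l′} phase163 · g183 · phaseNeg`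

T. Bałaban, *Propagators and renormalization transformations for lattice gauge theories. I*, Commun. Math.
Phys. **95**, 17–40 (1984) [`Balaban1984PropagatorsI`, cell paper B5].  What the paper PRINTS (verbatim; renders
`b2b-balaban-ref1/pages/1984-cmp95-propagators-rt-I/…-p007-x2.png` (journal p. 23), `…-p014-x2.png` (p. 30),
`…-p015-x2.png` (p. 31), `…-p017-x2.png` (p. 33), `…-p020-x2.png` (p. 36) read as images by this seat):
* p. 23 [PDF 7]: «To understand better regularity properties and bounds of the operators involved we write them in
  momentum representation. The momentum representation on an arbitrary torus T′_η = {x ∈ ηℤ^d : −L′_μ ≤ x_μ < L′_μ,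
  μ = 1, …, d} is introduced by the Fourier transform
  f̃(p) = Σ_{x∈T′_η} η^d e^{−ip·x} f(x), p ∈ T̃′_η,   f(x) = (2π)^{−d} Σ_{p∈T̃′_η} (Π_{μ=1}^d π/L′_μ) e^{ix·p} f̃(p),   (1.29)
  where T̃′_η is a dual torus …» and, same page: «p ∈ T̃_η is represented as a sum p = p′ + l, p′ ∈ T̃₁^{(k)} and
  l = (l₁, …, l_d), l_μ = 2πm_μ, m_μ is an integer, −(L^k − 1)/2 ≤ m_μ ≤ (L^k − 1)/2 for L odd, −L^k/2 ≤ m_μ < L^k/2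
  for L even.»;
* p. 30 [PDF 14]: «We will obtain an explicit representation of  Δ_a⁻¹ = G_k, or simply G.   (1.71)»;
* p. 31 [PDF 15]: «This gives the solution of Eq. (1.73), so G = Δ_a⁻¹. To investigate better the operator G we write
  it in momentum representation:» followed by the block formula (1.83) «… for p′ ≠ 0,  Ã_μ(l) = 1/Δ(l) · J̃_μ(l),
  Ã_μ(0) = a⁻¹ J̃_μ(0),» (full transcription of (1.83)–(1.84): headers of `B5Prop11Bound`, `B5G183Strip`);
* p. 33 [PDF 17], Proposition 1.1: «The operator G is a symmetric operator on L²(T_η) …»;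
* p. 36 [PDF 20], ll. 20–23 (NOT certified here, recorded as the printed road to decay): «Probably the simplest proof of
  the exponential decay properties can be obtained by relating G on the torus to G on the whole lattice ηℤ^d in the
  usual way, and then proving that the operator e^{−⟨q,x⟩}Δ_a e^{⟨q,x⟩} − Δ_a is a small perturbation of Δ_a …».

CITATION HEADER (lean-in-tree rule).  This module is a SUPPLEMENT, not a quotation: the paper passes from the operator
identity `G = Δ_a⁻¹` (1.71)/(1.73) to the momentum blocks (1.83) and back («in the usual way») without displaying the
position-space kernel.  Below that kernel is WRITTEN OUT AND KERNEL-CERTIFIED for the tree's objects: the lattice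
operator `Δ_a = B5DeltaA169.DeltaA n M a` (pv15, «G = Δ_a⁻¹» is the tree theorem `B5DeltaA169.calG_eq_DeltaA_inv`),
its Fourier-side inverse `𝒢 = F^* Ĝ F = B5Prop11Plancherel.calG` with block family `blocks` ((1.83) at `p′ ≠ 0`,
the zero fiber `G₀` at `p′ = 0`), the continued entry symbol `B5G183Strip.g183` (pv15-g10), its value at the origin
`B5G183Zero.g183_at0_eq_G₀` (this lineage), the block-point dictionary `B5Block118.pOf / up / iota / bpt / chi_pOf_up /
chi_pOf_iota` (pv15), and the phases `B5Hk163Decay.phase163`, `B5G183CovDecay.phaseNeg` of the symbol-side decay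
modules.  Everything is `[folklore]` audit mathematics (finite Fourier inversion); `[cite: …]` tags mark the location of
printed TEXT only.  ABSOLUTE RULE honoured: no statement of the papers is used as a hypothesis; the only imports are
kernel-proved tree modules.

DICTIONARY (print ↦ tree).  `T_η` (η = L^{−k} = 1/n on the block scale) ↦ `Tor (fine n M)` (`fine n M μ = n·M μ`);
the unit torus `T₁^{(k)}` and its dual `T̃₁^{(k)} ∋ p′` ↦ `Tor M ∋ y` resp. `Tor M ∋ q`, with the real representative
`p′(q) = sOf M q ∈ (−π, π]^d` (`valMinAbs` convention of `B5Prop11Plancherel`); the alias offset `l = 2πm` ↦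
`l : Fin d → Fin n` (offsets `{0, …, n−1}`, the tree's coset convention), the fine momentum `p = p′ + l` ↦
`B5Block118.pOf n M (l, q)` (`= (blockEquiv n M).symm`, `B5Block118.emb_eq`); `e^{ip·x}` ↦ `chi (fine n M) p x`,
`e^{ip′·y}` ↦ `chi M q y`; the unitary DFT `F` ↦ `dftV` (entries `δ_{μμ′}|T|^{−1/2}e^{−ip·x}`); block points
`x = n·y + r`, `y ∈ T₁`, `r ∈ {0,…,n−1}^d` ↦ `B5Block118.bpt n M y r = up n M y + iota n M r`;
`e^{iη(p′+l)·r}` ↦ `phase163 n l r (ofRealVec p′)`, its conjugate ↦ `phaseNeg n l r (ofRealVec p′)`.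

CONTENT (all `n ≥ 1`, all `d`, every multi-period `M`).
§1 the DFT sandwich entrywise: `(F^* B F)_{(x,μ),(x′,ν)} = |T|^{−1} Σ_{p,p′} e^{ip·x} B_{(p,μ),(p′,ν)} e^{−ip′·x′}`
   (`sandwich_apply`), for ANY momentum-space matrix `B` on any torus.
§2 the kernel of `𝒢` and of `Δ_a⁻¹`, every `a > 0`: `(Δ_a⁻¹)_{(x,μ),(x′,ν)} = |T_η|^{−1} Σ_{p′∈T̃₁} Σ_{l,l′}
   e^{i(p′+l)·x} [G(p′)]_{(l,μ),(l′,ν)} e^{−i(p′+l′)·x′}` (`calG_apply`, `DeltaA_inv_apply`; the transported block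
   matrix is block-diagonal in `p′`, `calGhat_pOf`).
§3 `a = 1`: `[G(p′(q))]_{(l,μ),(l′,ν)} = g183_{μν}(l, l′; p′(q))` for EVERY class `q`, the zero class through
   `g183_at0_eq_G₀` (`blocks_one_apply`), hence the kernel of `Δ_1⁻¹` from the continued symbol
   (`DeltaA_one_inv_apply`).
§4 the phase dictionary `e^{i(p′+l)·(ny+r)} = e^{ip′·y} · phase163(l, r, p′)`, `conj phase163 = phaseNeg` at real `p′`
   (`chi_pOf_bpt`, `conj_phase163_ofRealVec`), every point of `T_η` is a block point (`exists_eq_bpt`),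
   `|T_η| = n^d|T₁|` (`card_Tor_fine`), and the HEADLINE: `(Δ_1⁻¹)_{(ny+r,μ),(ny′+r′,ν)} = |T_η|^{−1} Σ_{q}
   e^{ip′_q·(y−y′)} Σ_{l,l′} phase163(l,r,p′_q) g183_{μν}(l,l′;p′_q) phaseNeg(l′,r′,p′_q)` (`DeltaA_one_inv_apply_bpt`;
   normalised `|T₁|^{−1}·n^{−d}` form `DeltaA_one_inv_apply_bpt'`) — the inner double sum has, summand by summand,
   the shape of `B5G183CovDecay.Mcov` (there with the covariant part `g183cov` in place of `g183`).
§5 corollaries for every `a > 0`: the kernel is real (`conj_DeltaA_inv_apply`, by `B5RealFields.isReal_DeltaA_inv`),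
   Hermitian hence SYMMETRIC (`DeltaA_inv_apply_swap`, `DeltaA_inv_apply_symm`), invariant under simultaneous
   coarse translations `x, x′ ↦ x + nt, x′ + nt` (`DeltaA_inv_apply_add_up`), and uniformly bounded entrywise,
   `|G_{(x,μ),(x′,ν)}| ≤ Cst(d, a)` (`norm_DeltaA_inv_apply_le`, from `B5DeltaA169.opNorm_DeltaA_inv_le`).

HONEST SCOPE.  (i) IDENTITIES ONLY: no decay statement of Proposition 1.1 is proved here — the exponential decay of
the kernel needs the analytic continuation / contour shift of the `q`-sum (the symbol side is `B5G183Strip`,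
`B5G183CovDecay`, `B5G183FreeDecay`, `B5G183Rate*`; the torus-vs-`ηℤ^d` comparison of p. 36 is not typed); this leaf
supplies the exact finite-volume starting formula those modules are to be plugged into.  (ii) CONVENTIONS: the tree's
coset representative `p′(q) ∈ (−π, π]^d` with offsets `l ∈ {0,…,n−1}^d` differs from the print's centred `m_μ` and
from `B4TorusKernel`'s `rep ∈ [−1/2, 1/2)`; the assembled entry `(Δ_a⁻¹)_{x x′}` is convention-free (it is a matrix
entry), but the individual summands `g183(l,l′;p′)` are relabelled under a change of representative — any entrywise
comparison with another alias convention, the `Fin d ↔ Fin (d+1)` bookkeeping of the four-dimensional consumers, the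
free/covariant splitting `g183 = g^{free} + g^{cov}` (`B5G183CovSplit`) inside the `l,l′`-sum, and Bałaban's
`η^d`-weighted kernel normalisation ((1.29); the tree matrix is the `ℓ²` matrix, dictionary in `B5DeltaA169`) are
left to the consumer.  (iii) `a = 1` for the identification with `g183` (§3, §4: the convention of `B5G183Strip`);
§2 and §5 hold for every `a > 0`.  (iv) Finite torus only; `n ≥ 1` is needed exactly where pv15's `blocks`/`calG`
need it.  (v) No `def` is introduced: every object is an existing tree declaration, used BY NAME.
-/

open scoped BigOperators Matrix ComplexConjugate Matrix.Norms.L2Operator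
open Finset Complex Matrix

namespace Literature.MathematicalPhysics.QuantumFieldTheory.Balaban1983to89.B5G183Kernel

open Literature.MathematicalPhysics.QuantumFieldTheory.Balaban1983to89.B4Strip
open Literature.MathematicalPhysics.QuantumFieldTheory.Balaban1983to89.B5Prop11Fiber
open Literature.MathematicalPhysics.QuantumFieldTheory.Balaban1983to89.B5Prop11Bound
open Literature.MathematicalPhysics.QuantumFieldTheory.Balaban1983to89.B5Prop11Plancherel
open Literature.MathematicalPhysics.QuantumFieldTheory.Balaban1983to89.B5Block118
  (cT conj_dft pOf emb_eq pOf_bijective card_fine up iota bpt chi_pOf_up chi_pOf_iota om upHom_intCast)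
open Literature.MathematicalPhysics.QuantumFieldTheory.Balaban1983to89.B5DeltaA169
open Literature.MathematicalPhysics.QuantumFieldTheory.Balaban1983to89.B5Prop11Lattice
open Literature.MathematicalPhysics.QuantumFieldTheory.Balaban1983to89.B5RealFields (isReal_DeltaA_inv)
open Literature.MathematicalPhysics.QuantumFieldTheory.Balaban1983to89.B5G183Strip (g183 g183_ofReal)
open Literature.MathematicalPhysics.QuantumFieldTheory.Balaban1983to89.B5G183Zero
  (g183_at0_eq_G₀ ofRealVec_zero_eq)
open Literature.MathematicalPhysics.QuantumFieldTheory.Balaban1983to89.B5Hk163Strip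
  (shift_ofRealVec_apply)
open Literature.MathematicalPhysics.QuantumFieldTheory.Balaban1983to89.B5Hk163Decay (phase163)
open Literature.MathematicalPhysics.QuantumFieldTheory.Balaban1983to89.B5G183CovDecay (phaseNeg)
open Literature.MathematicalPhysics.QuantumFieldTheory.Balaban1983to89.MatrixNorms
  (sum_norm_sq_col_le_opNorm_sq)

variable {d : ℕ}

/-! ## §1. The DFT sandwich `F^* B F` entrywise -/

section DFT

variable (N : Fin d → ℕ) [hN : ∀ μ, NeZero (N μ)]

/-- entries of `F^*`: `(F^*)_{(x,μ),(p,μ′)} = δ_{μμ′} |T|^{-1/2} e^{ip·x}`. [folklore] -/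
theorem star_dftV_apply (x : Tor N) (μ : Fin d) (p : Tor N) (μ' : Fin d) :
    (star (dftV N)) (x, μ) (p, μ') = if μ' = μ then (cT N : ℂ) * chi N p x else 0 := by
  rw [Matrix.star_apply, dftV_apply]
  split_ifs with h
  · rw [Complex.star_def, conj_dft]
  · rw [star_zero]

/-- `|T|^{-1/2} · |T|^{-1/2} = |T|^{-1}`. [folklore] -/
theorem cT_mul_cT : (cT N : ℂ) * (cT N : ℂ) = ((Fintype.card (Tor N) : ℂ))⁻¹ := by
  rw [← Complex.ofReal_mul, cT, ← mul_inv, Real.mul_self_sqrt (Nat.cast_nonneg _),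
    Complex.ofReal_inv, Complex.ofReal_natCast]

/-- THE SANDWICH FORMULA: `(F^* B F)_{(x,μ),(x′,ν)} = |T|^{-1} Σ_{p,p′} e^{ip·x} B_{(p,μ),(p′,ν)} e^{-ip′·x′}`
for any momentum-space matrix `B`. [folklore] -/
theorem sandwich_apply (B : Matrix (Tor N × Fin d) (Tor N × Fin d) ℂ) (x x' : Tor N) (μ ν : Fin d) :
    (star (dftV N) * B * dftV N) (x, μ) (x', ν)
      = ((Fintype.card (Tor N) : ℂ))⁻¹ *
          ∑ p : Tor N, ∑ p' : Tor N, chi N p x * B (p, μ) (p', ν) * conj (chi N p' x') := by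
  rw [Matrix.mul_apply]
  simp_rw [Matrix.mul_apply, Fintype.sum_prod_type, star_dftV_apply, dftV_apply,
    B5Block118.dft_apply']
  simp only [ite_mul, zero_mul, mul_ite, mul_zero, Finset.sum_ite_eq', Finset.mem_univ, if_true]
  have step : ∀ p p' : Tor N,
      (cT N : ℂ) * chi N p x * B (p, μ) (p', ν) * ((cT N : ℂ) * conj (chi N p' x'))
        = ((cT N : ℂ) * (cT N : ℂ)) * (chi N p x * B (p, μ) (p', ν) * conj (chi N p' x')) := by
    intro p p'
    ring
  simp_rw [Finset.sum_mul, step, ← Finset.mul_sum, cT_mul_cT]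
  rw [Finset.sum_comm]

end DFT

/-! ## §2. The position-space kernel of `𝒢 = F^* Ĝ F = Δ_a⁻¹` -/

section Kernel

variable (n : ℕ) [NeZero n] (hn : 1 ≤ n) (M : Fin d → ℕ) [hM : ∀ μ, NeZero (M μ)]
  (a : ℝ) (ha : 0 < a)

/-- the transported block matrix at two coset momenta: `Ĝ_{(p′+l,μ),(p″+l′,ν)} = δ_{p′p″} [G(p′)]_{(l,μ),(l′,ν)}`.
[folklore] -/
theorem calGhat_pOf (kq kq' : (Fin d → Fin n) × Tor M) (μ ν : Fin d) :
    calGhat n hn M a ha (pOf n M kq, μ) (pOf n M kq', ν)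
      = if kq.2 = kq'.2 then blocks n hn M a ha kq.2 (kq.1, μ) (kq'.1, ν) else 0 := by
  obtain ⟨k, q⟩ := kq
  obtain ⟨k', q'⟩ := kq'
  have h1 : blockEquiv n M (pOf n M (k, q), μ) = ((k, μ), q) :=
    (blockEquiv n M).apply_symm_apply ((k, μ), q)
  have h2 : blockEquiv n M (pOf n M (k', q'), ν) = ((k', ν), q') :=
    (blockEquiv n M).apply_symm_apply ((k', ν), q')
  rw [calGhat, Matrix.reindex_symm, Matrix.reindex_apply, Matrix.submatrix_apply]
  show Matrix.blockDiagonal (blocks n hn M a ha) (blockEquiv n M (pOf n M (k, q), μ))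
      (blockEquiv n M (pOf n M (k', q'), ν)) = _
  rw [h1, h2, Matrix.blockDiagonal_apply']

/-- reindexing a sum over fine momenta by `(l, p′) ↦ p′ + l`. [folklore] -/
theorem sum_pOf (g : Tor (fine n M) → ℂ) :
    ∑ p, g p = ∑ kq : (Fin d → Fin n) × Tor M, g (pOf n M kq) :=
  ((pOf_bijective n M).sum_comp g).symm

/-- **THE KERNEL OF `𝒢 = F^* Ĝ F`**: for every `a > 0`, `n ≥ 1` and all `(x,μ)`, `(x′,ν)`,
`𝒢_{(x,μ),(x′,ν)} = |T_η|^{-1} Σ_{p′ ∈ T̃₁} Σ_{l,l′} e^{i(p′+l)·x} [G(p′)]_{(l,μ),(l′,ν)} e^{−i(p′+l′)·x′}`,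
with `G(p′)` the block family `blocks` ((1.83) at `p′ ≠ 0`, `G₀` at `p′ = 0`). [folklore] -/
theorem calG_apply (x x' : Tor (fine n M)) (μ ν : Fin d) :
    calG n hn M a ha (x, μ) (x', ν)
      = ((Fintype.card (Tor (fine n M)) : ℂ))⁻¹ *
          ∑ q : Tor M, ∑ k : Fin d → Fin n, ∑ k' : Fin d → Fin n,
            chi (fine n M) (pOf n M (k, q)) x * blocks n hn M a ha q (k, μ) (k', ν)
              * conj (chi (fine n M) (pOf n M (k', q)) x') := by
  rw [calG, sandwich_apply]
  congr 1
  rw [sum_pOf]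
  simp_rw [sum_pOf n M (fun p' => chi (fine n M) _ x * calGhat n hn M a ha (_, μ) (p', ν) * conj (chi (fine n M) p' x')),
    calGhat_pOf]
  simp only [Fintype.sum_prod_type, mul_ite, mul_zero, ite_mul, zero_mul, Finset.sum_ite_eq,
    Finset.mem_univ, if_true]
  rw [Finset.sum_comm]

/-- **THE KERNEL OF `G = Δ_a⁻¹` ON `T_η`** (B5 (1.71): `Δ_a⁻¹ = G`; `𝒢 = Δ_a⁻¹` is the tree's
`B5DeltaA169.calG_eq_DeltaA_inv`): for every `a > 0`, `n ≥ 1`,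
`(Δ_a⁻¹)_{(x,μ),(x′,ν)} = |T_η|^{-1} Σ_{p′} Σ_{l,l′} e^{i(p′+l)·x} [G(p′)]_{(l,μ),(l′,ν)} e^{−i(p′+l′)·x′}`.
[cite: Balaban1984PropagatorsI, (1.71) p.30 and (1.83) p.31 (text of the formulas only; the identity is ours)] -/
theorem DeltaA_inv_apply (x x' : Tor (fine n M)) (μ ν : Fin d) :
    (DeltaA n M a)⁻¹ (x, μ) (x', ν)
      = ((Fintype.card (Tor (fine n M)) : ℂ))⁻¹ *
          ∑ q : Tor M, ∑ k : Fin d → Fin n, ∑ k' : Fin d → Fin n,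
            chi (fine n M) (pOf n M (k, q)) x * blocks n hn M a ha q (k, μ) (k', ν)
              * conj (chi (fine n M) (pOf n M (k', q)) x') := by
  rw [← calG_eq_DeltaA_inv n hn M a ha]
  exact calG_apply n hn M a ha x x' μ ν

/-! ## §3. `a = 1`: the blocks ARE the continued symbol `g183` at the real momenta `p′(q)` — every coset,
`p′ = 0` included -/

/-- for `a = 1` and every coarse class `q` (also `q = 0`): `[blocks q]_{(l,μ),(l′,ν)} = g183_{μν}(l,l′; p′(q))`.
[folklore] -/
theorem blocks_one_apply (q : Tor M) (μ ν : Fin d) (k k' : Fin d → Fin n) :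
    blocks n hn M 1 one_pos q (k, μ) (k', ν) = g183 n μ ν k k' (ofRealVec (sOf M q)) := by
  by_cases hq : q = 0
  · subst hq
    rw [blocks, dif_pos rfl, sOf_zero, ofRealVec_zero_eq, g183_at0_eq_G₀]
  · rw [blocks, dif_neg hq]
    exact (g183_ofReal n hn (sOf M q) (abs_sOf_le M q) (sOf_ne_zero M hq) μ ν k k').symm

include hn in
/-- **THE KERNEL OF `G = Δ_1⁻¹` FROM THE CONTINUED SYMBOL**: for `a = 1`, every `n ≥ 1`,
`(Δ_1⁻¹)_{(x,μ),(x′,ν)} = |T_η|^{-1} Σ_{q} Σ_{l,l′} e^{i(p′_q+l)·x} g183_{μν}(l,l′;p′_q) e^{−i(p′_q+l′)·x′}`.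
[cite: Balaban1984PropagatorsI, (1.83) p.31 (text of the formula only; the identity is ours)] -/
theorem DeltaA_one_inv_apply (x x' : Tor (fine n M)) (μ ν : Fin d) :
    (DeltaA n M 1)⁻¹ (x, μ) (x', ν)
      = ((Fintype.card (Tor (fine n M)) : ℂ))⁻¹ *
          ∑ q : Tor M, ∑ k : Fin d → Fin n, ∑ k' : Fin d → Fin n,
            chi (fine n M) (pOf n M (k, q)) x * g183 n μ ν k k' (ofRealVec (sOf M q))
              * conj (chi (fine n M) (pOf n M (k', q)) x') := by
  rw [DeltaA_inv_apply n hn M 1 one_pos]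
  simp_rw [blocks_one_apply]

/-! ## §4. The fine/coarse phase dictionary at real momenta and the kernel on block points `x = n·y + r` -/

omit [NeZero n] in
/-- `ω_ν(l, p′) = e^{iη(p′+l)_ν}` is the phase of `B5Hk163Decay.phase163`. [folklore] -/
theorem om_eq_exp_shift (k : Fin d → Fin n) (s : Fin d → ℝ) (ν : Fin d) :
    om n k s ν = Complex.exp (shift n k (ofRealVec s) ν / n * I) := by
  rw [om, shift_ofRealVec_apply]
  push_cast
  rfl

/-- `e^{i(p′+l)·(ηr)} = phase163(l, r, p′)` at real `p′ = p′(q)`. [folklore] -/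
theorem chi_pOf_iota_eq_phase163 (k : Fin d → Fin n) (q : Tor M) (r : Fin d → Fin n) :
    chi (fine n M) (pOf n M (k, q)) (iota n M r) = phase163 n k r (ofRealVec (sOf M q)) := by
  rw [chi_pOf_iota, phase163]
  exact Finset.prod_congr rfl fun ν _ => by rw [om_eq_exp_shift]

/-- **THE PHASE DICTIONARY**: at the block point `x = n·y + r` (`y ∈ T₁`, `r ∈ {0,…,n−1}^d`),
`e^{i(p′+l)·x} = e^{ip′·y} · phase163(l, r, p′)` (`l·(ny) ∈ 2πℤ`). [folklore] -/
theorem chi_pOf_bpt (k : Fin d → Fin n) (q y : Tor M) (r : Fin d → Fin n) :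
    chi (fine n M) (pOf n M (k, q)) (bpt n M y r) = chi M q y * phase163 n k r (ofRealVec (sOf M q)) := by
  rw [bpt, chi_add_right, chi_pOf_up, chi_pOf_iota_eq_phase163]

omit [NeZero n] in
/-- at real momenta the conjugate phase is `B5G183CovDecay.phaseNeg`: `conj phase163(l,r,p′) = phaseNeg(l,r,p′)`.
[folklore] -/
theorem conj_phase163_ofRealVec (k b : Fin d → Fin n) (s : Fin d → ℝ) :
    conj (phase163 n k b (ofRealVec s)) = phaseNeg n k b (ofRealVec s) := by
  rw [phase163, phaseNeg, map_prod]
  refine Finset.prod_congr rfl fun ν _ => ?_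
  rw [map_pow, ← Complex.exp_conj, shift_ofRealVec_apply]
  congr 2
  rw [map_mul, map_div₀, Complex.conj_ofReal, Complex.conj_natCast, Complex.conj_I]
  ring

include hn in
/-- **`G = Δ_1⁻¹` ON BLOCK POINTS = COARSE-TORUS FOURIER INVERSION OF THE FINE-OFFSET MULTIPLIER**:
for `a = 1`, `n ≥ 1`, `y, y′ ∈ T₁`, `r, r′ ∈ {0,…,n−1}^d`,
`(Δ_1⁻¹)_{(ny+r,μ),(ny′+r′,ν)} = |T_η|^{-1} Σ_{q ∈ T̃₁} e^{ip′_q·(y−y′)} Σ_{l,l′} phase163(l,r,p′_q) g183_{μν}(l,l′;p′_q) phaseNeg(l′,r′,p′_q)`.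
[cite: Balaban1984PropagatorsI, (1.29) p.23 and (1.83) p.31 (text of the formulas only; the identity is ours)] -/
theorem DeltaA_one_inv_apply_bpt (y y' : Tor M) (r r' : Fin d → Fin n) (μ ν : Fin d) :
    (DeltaA n M 1)⁻¹ (bpt n M y r, μ) (bpt n M y' r', ν)
      = ((Fintype.card (Tor (fine n M)) : ℂ))⁻¹ *
          ∑ q : Tor M, chi M q (y - y') *
            ∑ k : Fin d → Fin n, ∑ k' : Fin d → Fin n,
              phase163 n k r (ofRealVec (sOf M q)) * g183 n μ ν k k' (ofRealVec (sOf M q))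
                * phaseNeg n k' r' (ofRealVec (sOf M q)) := by
  rw [DeltaA_one_inv_apply n hn M]
  congr 1
  refine Finset.sum_congr rfl fun q _ => ?_
  -- `e^{ip′·(y−y′)} = e^{ip′·y} conj e^{ip′·y′}` (landed as `B5Hk163TorusHolderRate.chi_sub_right`; its one-line proof is
  -- inlined here to keep this leaf's import closure free of the Hölder-rate modules)
  have hsub : chi M q (y - y') = chi M q y * conj (chi M q y') := by
    rw [sub_eq_add_neg, chi_add_right, conj_chi, ← chi_neg_neg M (-q) y', neg_neg]
  rw [hsub, Finset.mul_sum]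
  refine Finset.sum_congr rfl fun k _ => ?_
  rw [Finset.mul_sum]
  refine Finset.sum_congr rfl fun k' _ => ?_
  rw [chi_pOf_bpt, chi_pOf_bpt, map_mul, conj_phase163_ofRealVec]
  ring

/-- every point of `T_η` is a block point `x = n·y + r`. [folklore] -/
theorem exists_eq_bpt (x : Tor (fine n M)) : ∃ (y : Tor M) (r : Fin d → Fin n), x = bpt n M y r := by
  have hn0 : 0 < n := Nat.pos_of_ne_zero (NeZero.ne n)
  refine ⟨fun ν => (((x ν).val / n : ℕ) : ZMod (M ν)), fun ν => ⟨(x ν).val % n, Nat.mod_lt _ hn0⟩, ?_⟩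
  funext ν
  show x ν = up n M _ ν + iota n M _ ν
  simp only [up, iota]
  rw [show ((((x ν).val / n : ℕ)) : ZMod (M ν)) = ((((x ν).val / n : ℕ) : ℤ) : ZMod (M ν)) by
    rw [Int.cast_natCast], upHom_intCast, Int.cast_natCast]
  have h : ((x ν).val : ZMod (fine n M ν)) = x ν := ZMod.natCast_zmod_val (x ν)
  conv_lhs => rw [← h, ← Nat.div_add_mod (x ν).val n]
  push_cast
  ring

/-- `|T_η| = n^d |T₁|` (so `|T_η|^{-1} Σ_q = |T₁|^{-1} Σ_q n^{-d}`). [folklore] -/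
theorem card_Tor_fine :
    (Fintype.card (Tor (fine n M)) : ℂ) = (n : ℂ) ^ d * (Fintype.card (Tor M) : ℂ) := by
  exact_mod_cast card_fine n M

include hn in
/-- the same kernel with the normalisation split `|T_η|^{-1} = |T₁|^{-1} · n^{-d}`:
`(Δ_1⁻¹)_{(ny+r,μ),(ny′+r′,ν)} = |T₁|^{-1} Σ_q e^{ip′_q·(y−y′)} · n^{-d} Σ_{l,l′} phase163 · g183 · phaseNeg` — the
coarse-torus Fourier inversion ((1.29) on `T₁`) of the fine-offset multiplier `n^{-d} Σ_{l,l′} …`. [folklore] -/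
theorem DeltaA_one_inv_apply_bpt' (y y' : Tor M) (r r' : Fin d → Fin n) (μ ν : Fin d) :
    (DeltaA n M 1)⁻¹ (bpt n M y r, μ) (bpt n M y' r', ν)
      = ((Fintype.card (Tor M) : ℂ))⁻¹ *
          ∑ q : Tor M, chi M q (y - y') *
            (((n : ℂ) ^ d)⁻¹ * ∑ k : Fin d → Fin n, ∑ k' : Fin d → Fin n,
              phase163 n k r (ofRealVec (sOf M q)) * g183 n μ ν k k' (ofRealVec (sOf M q))
                * phaseNeg n k' r' (ofRealVec (sOf M q))) := by
  rw [DeltaA_one_inv_apply_bpt n hn M, card_Tor_fine, mul_comm ((n : ℂ) ^ d), mul_inv, mul_assoc]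
  refine congrArg (fun s => ((Fintype.card (Tor M) : ℂ))⁻¹ * s) ?_
  rw [Finset.mul_sum]
  exact Finset.sum_congr rfl fun q _ => by ring

/-! ## §5. Corollaries: Hermitian symmetry, coarse-translation invariance, uniform entry bound -/

include hn ha in
/-- `G_{(x′,ν),(x,μ)} = conj G_{(x,μ),(x′,ν)}` («G is a symmetric operator», typed `DeltaA_inv_isHermitian`).
[cite: Balaban1984PropagatorsI, Prop. 1.1 p.33 (proof ours)] -/
theorem DeltaA_inv_apply_swap (x x' : Tor (fine n M)) (μ ν : Fin d) :
    (DeltaA n M a)⁻¹ (x', ν) (x, μ) = conj ((DeltaA n M a)⁻¹ (x, μ) (x', ν)) := by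
  have h := (DeltaA_inv_isHermitian n hn M a ha).apply (x', ν) (x, μ)
  rw [← h]
  rfl

/-- the kernel is REAL: `conj G_{(x,μ),(x′,ν)} = G_{(x,μ),(x′,ν)}` (the tree's `B5RealFields.isReal_DeltaA_inv`, by name).
[folklore] -/
theorem conj_DeltaA_inv_apply (x x' : Tor (fine n M)) (μ ν : Fin d) :
    conj ((DeltaA n M a)⁻¹ (x, μ) (x', ν)) = (DeltaA n M a)⁻¹ (x, μ) (x', ν) :=
  isReal_DeltaA_inv n M a (x, μ) (x', ν)

include hn ha in
/-- the kernel is SYMMETRIC: `G_{(x′,ν),(x,μ)} = G_{(x,μ),(x′,ν)}` (Hermitian and real). [cite: Balaban1984PropagatorsI,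
Prop. 1.1 p.33 («The operator G is a symmetric operator on L²(T_η)»; proof ours)] -/
theorem DeltaA_inv_apply_symm (x x' : Tor (fine n M)) (μ ν : Fin d) :
    (DeltaA n M a)⁻¹ (x', ν) (x, μ) = (DeltaA n M a)⁻¹ (x, μ) (x', ν) := by
  rw [DeltaA_inv_apply_swap n hn M a ha, conj_DeltaA_inv_apply]

/-- hence the momentum sum of §2 is real: its imaginary part vanishes. [folklore] -/
theorem DeltaA_inv_apply_im (x x' : Tor (fine n M)) (μ ν : Fin d) :
    ((DeltaA n M a)⁻¹ (x, μ) (x', ν)).im = 0 := by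
  have h := conj_DeltaA_inv_apply n M a x x' μ ν
  exact Complex.conj_eq_iff_im.mp h

/-- `e^{ip′·t} conj e^{ip′·t} = 1`. [folklore] -/
theorem chi_mul_conj_self (q t : Tor M) : chi M q t * conj (chi M q t) = 1 := by
  rw [conj_chi, ← chi_add_left, add_neg_cancel, chi_zero_left]

include hn ha in
/-- **COARSE-TRANSLATION INVARIANCE**: `G_{(x+nt,μ),(x′+nt,ν)} = G_{(x,μ),(x′,ν)}` for every unit-lattice
vector `t ∈ T₁` (the characters `e^{i(p′+l)·nt} = e^{ip′·t}` do not see the alias index). [folklore] -/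
theorem DeltaA_inv_apply_add_up (x x' : Tor (fine n M)) (t : Tor M) (μ ν : Fin d) :
    (DeltaA n M a)⁻¹ (x + up n M t, μ) (x' + up n M t, ν) = (DeltaA n M a)⁻¹ (x, μ) (x', ν) := by
  have h1 := DeltaA_inv_apply n hn M a ha (x + up n M t) (x' + up n M t) μ ν
  have h2 := DeltaA_inv_apply n hn M a ha x x' μ ν
  rw [h1, h2]
  refine congrArg _ ?_
  refine Finset.sum_congr rfl fun q _ => Finset.sum_congr rfl fun k _ => Finset.sum_congr rfl fun k' _ => ?_
  rw [chi_add_right, chi_add_right, chi_pOf_up, chi_pOf_up, map_mul]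
  calc chi (fine n M) (pOf n M (k, q)) x * chi M q t * blocks n hn M a ha q (k, μ) (k', ν)
          * (conj (chi (fine n M) (pOf n M (k', q)) x') * conj (chi M q t))
        = chi (fine n M) (pOf n M (k, q)) x * blocks n hn M a ha q (k, μ) (k', ν)
            * conj (chi (fine n M) (pOf n M (k', q)) x') * (chi M q t * conj (chi M q t)) := by ring
    _ = _ := by rw [chi_mul_conj_self, mul_one]

include hn ha in
/-- **UNIFORM ENTRY BOUND**: `|G_{(x,μ),(x′,ν)}| ≤ ‖G‖ ≤ Cst(d,a)` (the tree's operator bound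
`B5DeltaA169.opNorm_DeltaA_inv_le`), uniform in `n`, `T_η`, `x`, `x′`. [folklore] -/
theorem norm_DeltaA_inv_apply_le (x x' : Tor (fine n M)) (μ ν : Fin d) :
    ‖(DeltaA n M a)⁻¹ (x, μ) (x', ν)‖ ≤ Cst d a := by
  have h1 : ‖(DeltaA n M a)⁻¹ (x, μ) (x', ν)‖ ^ 2 ≤ ‖(DeltaA n M a)⁻¹‖ ^ 2 :=
    le_trans (Finset.single_le_sum (f := fun i => ‖(DeltaA n M a)⁻¹ i (x', ν)‖ ^ 2)
      (fun i _ => sq_nonneg _) (Finset.mem_univ (x, μ)))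
      (sum_norm_sq_col_le_opNorm_sq _ (x', ν))
  have h2 : ‖(DeltaA n M a)⁻¹ (x, μ) (x', ν)‖ ≤ ‖(DeltaA n M a)⁻¹‖ :=
    (pow_le_pow_iff_left₀ (norm_nonneg _) (norm_nonneg _) two_ne_zero).mp h1
  exact h2.trans (opNorm_DeltaA_inv_le n hn M a ha)

end Kernel

end Literature.MathematicalPhysics.QuantumFieldTheory.Balaban1983to89.B5G183Kernel
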